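import Mathlib
import Literature.Dynamics.Hamiltonian.KaloshinZhang2020.CuspDensity

/-!
# From cusp-open-dense to residually many dense amplitude slices: the converse comparison lemma (L-gen-1)

CITATION HEADER (lean-in-tree rule 2026-08-18). A PROVED abstract lemma (point-set topology only), companion of
`Literature.Dynamics.Hamiltonian.KaloshinZhang2020.CuspDensity` (L-gen-2), written by the pub-arnold near-miss cell
to complete the typed comparison of the two genericity classes in print for Arnold diffusion in nearly integrable
systems:
* Kaloshin–Zhang, *Arnold diffusion for smooth systems of two and a half degrees of freedom*, Ann. of Math.
  Stud. 208 (2020), Thm 1.2 (bib key `KaloshinZhang2020`): an open dense set `𝒰` of directions, a LOWER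
  SEMICONTINUOUS `ε₀`, and an OPEN AND DENSE `𝒲` inside the cusp `𝒱(𝒰, ε₀) = {εH₁ : H₁ ∈ 𝒰, 0 < ε < ε₀(H₁)}`
  (`KZCuspGeneric` of `KaloshinZhang2020.TheoremShapes`);
* Cheng–Xue (bib key `ChengXue2023`), in the 2013/2015 FORM of the definition (arXiv:1503.04153v1 p. 4; Cheng,
  Cambridge J. Math. 5 (2017) p. 217; Cheng, Asian J. Math. 23 (2019) §1): a RESIDUAL set `ℜ` of directions and
  for each `P ∈ ℜ` a residual set `R_P ⊆ [0, a_P]` of good amplitudes (`CXCuspResidual`).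
PROVENANCE NOTE (cell DIVERGENCE D30, GAPS 2026-08-18T18:45Z / 19:00Z; added 2026-08-18, litref g10): the text sent
to print, arXiv:1503.04153v5 `n-diffusion05082019.tex` l.208 (= Sci. China Math. 66 (2023) proxy), defines the
direction set ℜ_a as OPEN-DENSE in the sphere (`CXCuspOpenDense`, `TheoremShapes.lean`). The slice argument of this
file yields RESIDUAL direction sets only: it proves KZ-class ⇒ CX-2015-class, and it CANNOT yield the v5 class —
`CuspSlicesCounterexample.lean` (abstract data) and `GenericityClassesCounterexample.lean` (typed classes, every
finite-dimensional normed space of dimension ≥ 2). So "completes the typed comparison" below is to be read with "CX"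
= the 2015 class; for the v5 class the comparison has a second asymmetric input (openness of ℜ), see
`GenericityClassesCounterexample.lean`.
L-gen-2 (`cusp_dense_of_fibrewise_dense`) is the passage residual-fibres ⇒ open-dense-in-the-cusp under the
named hypothesis `(l)` (lower semicontinuity of the cusp height along `ℜ`). THIS file is the other direction:
open-and-dense-in-the-cusp ⇒ for a RESIDUAL set of directions the fibre of good amplitudes is open and dense in
`(0, a P)` — the "Kuratowski–Ulam-type slice argument" flagged as L-gen-1 in the cell's LEMMAS.md §3 G8′.
KERNEL FINDING recorded by this file: in this direction NO HYPOTHESIS WHATSOEVER on the height function `a = ε₀` is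
used (not lower semicontinuity, not even measurability) — only that `W` is open in `ℝ × X` (or relatively open in
the cusp, `residual_setOf_slice_dense_of_relOpen`) and dense in the cusp. So the asymmetry between the two
genericity classes (2015 form) sits entirely in the direction CX ⇒ KZ (hypothesis `(l)` of L-gen-2); KZ ⇒ CX-2015 is
unconditional point-set topology (for the v5 open-dense form see the PROVENANCE NOTE above). No Baire hypothesis is needed to STATE or PROVE residuality (it is needed only
to make a residual set of directions non-empty/dense, in the interpretation `X` = unit sphere of `Cʳ`, a complete
metric space). All results are kernel-checked and tagged [folklore]; nothing is specific to Hamiltonian dynamics.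

Setting (as in `CuspDensity`): directions `P : X`, amplitudes `λ : ℝ`, `(λ, P)` standing for `λ • P` (on
`(0, ∞) × sphere` the map `(λ, P) ↦ λ • P` is a homeomorphism onto the punctured cone), `cuspSet a = {0 < λ < a P}`.
* `slice W P = {λ | (λ, P) ∈ W}` — the amplitude fibre over `P`; open when `W` is (`isOpen_slice`).
* `isOpen_cuspSet`: the cusp over a lower semicontinuous height is open (so "`𝒲` open dense in `𝒱`" in KZ's
  class may be read in the ambient topology; the ONLY use of lower semicontinuity in this file).
* `residual_setOf_slice_dense` (L-gen-1): `W` open, `cuspSet a ⊆ closure W` ⇒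
  `{P | (0, a P) ⊆ closure (slice W P ∩ (0, a P))}` is residual in `X`.
  Proof: for rationals `0 ≤ q₁ < q₂` the set `D_{q₁,q₂} = π_X(W ∩ ((q₁,q₂) × X)) ∪ interior {a ≤ q₁}` is open and
  dense; a direction in all of them has a `W`-amplitude in every rational interval inside `(0, a P)`.
* `residual_setOf_slice_dense_of_relOpen`: the same for `W = O ∩ cusp` relatively open and dense in the cusp.
* `residual_setOf_fibre_dense_of_cusp_dense`: the same conclusion from the OUTPUT format of L-gen-2 / KZ's Thm 1.2
  (`Good` open, `Good ∩ cusp` dense in the cusp); `residual_setOf_fibre_dense_of_fibrewise_dense` chains L-gen-2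
  and L-gen-1 (residual in, residual out).
What is NOT here: the transport to the normed-space vocabulary of `KZCuspGeneric`/`CXCuspResidual` (the cone
homeomorphism; cell file DIVERGENCE.md rows L9/L14), and any statement about Hamiltonian systems.
-/

open Set Filter
open scoped Topology

namespace Literature.Dynamics.Hamiltonian.KaloshinZhang2020

/-- The amplitude SLICE (fibre) of `W ⊆ ℝ × X` over the direction `P`: `{λ | (λ, P) ∈ W}` — for `W = 𝒲` of
KZ20 Thm 1.2 and a direction `H₁`, the set of `ε` with `εH₁ ∈ 𝒲`; for Cheng–Xue the set `R_P`. [folklore] -/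
def slice {X : Type*} (W : Set (ℝ × X)) (P : X) : Set ℝ := {l | (l, P) ∈ W}

/-- Unfolding of `slice`. [folklore] -/
@[simp] theorem mem_slice {X : Type*} (W : Set (ℝ × X)) (P : X) (l : ℝ) : l ∈ slice W P ↔ (l, P) ∈ W :=
  Iff.rfl

/-- A slice of an open set is open (preimage under the continuous map `λ ↦ (λ, P)`). [folklore] -/
theorem isOpen_slice {X : Type*} [TopologicalSpace X] {W : Set (ℝ × X)} (hW : IsOpen W) (P : X) :
    IsOpen (slice W P) :=
  hW.preimage (f := fun l : ℝ => (l, P)) (by fun_prop)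

/-- The cusp `{(λ, P) | 0 < λ < a P}` over a LOWER SEMICONTINUOUS height `a` is open in `ℝ × X` (KZ20 build
`ε₀` lower semicontinuous, arXiv:1212.1150v3 `diffusion-scheme.tex` l.711–719; this is what makes "open and dense
in `𝒱(𝒰, ε₀)`" a statement about an open subset of the perturbation space). [folklore] -/
theorem isOpen_cuspSet {X : Type*} [TopologicalSpace X] {a : X → ℝ} (hlsc : LowerSemicontinuous a) :
    IsOpen (cuspSet a) := by
  rw [isOpen_iff_mem_nhds]
  rintro ⟨l₀, P₀⟩ ⟨h0, ha⟩
  obtain ⟨c, hlc, hca⟩ := exists_between ha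
  -- the box `(0, c) × {P | c < a P}` is a neighbourhood of `(l₀, P₀)` inside the cusp
  have hP : {P : X | c < a P} ∈ 𝓝 P₀ := (hlsc.isOpen_preimage c).mem_nhds hca
  have hl : Ioo (0 : ℝ) c ∈ 𝓝 l₀ := Ioo_mem_nhds h0 hlc
  refine Filter.mem_of_superset (prod_mem_nhds hl hP) ?_
  rintro ⟨l, P⟩ ⟨⟨hl0, hlc'⟩, hcP⟩
  exact ⟨hl0, lt_trans hlc' hcP⟩

/-- The open dense sets of the slice argument: for rationals `q₁ < q₂` with `0 ≤ q₁`,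
`D = π_X (W ∩ ((q₁, q₂) × X)) ∪ interior {P | a P ≤ q₁}`. [folklore] -/
def sliceWitnessSet {X : Type*} [TopologicalSpace X] (a : X → ℝ) (W : Set (ℝ × X)) (q₁ q₂ : ℚ) : Set X :=
  Prod.snd '' (W ∩ (Ioo (q₁ : ℝ) q₂) ×ˢ univ) ∪ interior {P | a P ≤ q₁}

/-- Each `D_{q₁,q₂}` is open (projections of open sets along `ℝ × X → X` are open). [folklore] -/
theorem isOpen_sliceWitnessSet {X : Type*} [TopologicalSpace X] (a : X → ℝ) {W : Set (ℝ × X)}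
    (hW : IsOpen W) (q₁ q₂ : ℚ) : IsOpen (sliceWitnessSet a W q₁ q₂) :=
  (isOpenMap_snd _ (hW.inter (isOpen_Ioo.prod isOpen_univ))).union isOpen_interior

/-- Each `D_{q₁,q₂}` with `0 ≤ q₁ < q₂` is dense, provided `W` is dense in the cusp: near a direction `P₀` with
`a P₀ > q₁` there is a cusp point `(λ₀, P₀)` with `λ₀ ∈ (q₁, q₂)`, hence a point of `W` with amplitude in
`(q₁, q₂)` over a nearby direction; near a direction where `a ≤ q₁` on a whole neighbourhood we are in the
interior term. [folklore] -/
theorem dense_sliceWitnessSet {X : Type*} [TopologicalSpace X] {a : X → ℝ} {W : Set (ℝ × X)}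
    (hWd : cuspSet a ⊆ closure W) {q₁ q₂ : ℚ} (hq0 : 0 ≤ q₁) (hq : q₁ < q₂) :
    Dense (sliceWitnessSet a W q₁ q₂) := by
  rw [dense_iff_inter_open]
  intro N hN hNne
  by_cases h : ∃ P₀ ∈ N, (q₁ : ℝ) < a P₀
  · obtain ⟨P₀, hP₀N, hP₀a⟩ := h
    have hq' : (q₁ : ℝ) < min (q₂ : ℝ) (a P₀) := lt_min (by exact_mod_cast hq) hP₀a
    obtain ⟨l₀, hl₁, hl₂⟩ := exists_between hq'
    have hl0 : 0 < l₀ := lt_of_le_of_lt (by exact_mod_cast hq0) hl₁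
    have hcusp : (l₀, P₀) ∈ cuspSet a := ⟨hl0, lt_of_lt_of_le hl₂ (min_le_right _ _)⟩
    have hclos := hWd hcusp
    rw [mem_closure_iff] at hclos
    obtain ⟨⟨l, P⟩, ⟨⟨hlI, hPN⟩, hlPW⟩⟩ :=
      hclos (Ioo (q₁ : ℝ) q₂ ×ˢ N) (isOpen_Ioo.prod hN)
        ⟨⟨hl₁, lt_of_lt_of_le hl₂ (min_le_left _ _)⟩, hP₀N⟩
    refine ⟨P, hPN, Or.inl ⟨(l, P), ⟨hlPW, hlI, mem_univ _⟩, rfl⟩⟩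
  · push Not at h
    obtain ⟨P₀, hP₀⟩ := hNne
    have hsub : N ⊆ interior {P | a P ≤ q₁} :=
      (hN.subset_interior_iff).2 (fun P hP => h P hP)
    exact ⟨P₀, hP₀, Or.inr (hsub hP₀)⟩

/-- **L-gen-1 (KZ-class ⇒ residually many open-dense fibres).** Let `W ⊆ ℝ × X` be OPEN with the cusp
`{0 < λ < a P}` contained in its closure; NOTHING is assumed about the height `a : X → ℝ`. Then for a RESIDUAL set
of directions `P` the amplitude slice of `W` is dense in `(0, a P)` (it is open by `isOpen_slice`): every
`λ ∈ (0, a P)` is a limit of `W`-amplitudes over `P` lying in `(0, a P)`. With `X` = the unit sphere of `Cʳ`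
(complete metric, hence Baire), `W` = KZ20's `𝒲` and `a = ε₀`, this says that Kaloshin–Zhang's genericity class
implies the Cheng–Xue "cusp-residual" form with OPEN DENSE (in particular residual) fibres `R_P ⊇ slice ∩ (0, ε₀ P)`
over a residual set of directions — the implication "KZ-form ⇒ CX-form" of the cell's comparison table, with no
analytic input at all. [folklore] -/
theorem residual_setOf_slice_dense {X : Type*} [TopologicalSpace X]
    (a : X → ℝ) (W : Set (ℝ × X)) (hWo : IsOpen W) (hWd : cuspSet a ⊆ closure W) :
    {P : X | Ioo 0 (a P) ⊆ closure (slice W P ∩ Ioo 0 (a P))} ∈ residual X := by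
  -- the countable family of open dense sets, indexed by admissible rational pairs
  let Q := {q : ℚ × ℚ // 0 ≤ q.1 ∧ q.1 < q.2}
  have hD : ∀ q : Q, sliceWitnessSet a W q.1.1 q.1.2 ∈ residual X := fun q =>
    residual_of_dense_open (isOpen_sliceWitnessSet a hWo _ _) (dense_sliceWitnessSet hWd q.2.1 q.2.2)
  have hI : (⋂ q : Q, sliceWitnessSet a W q.1.1 q.1.2) ∈ residual X := (countable_iInter_mem).2 hD
  refine Filter.mem_of_superset hI ?_
  intro P hP l ⟨hl0, hla⟩
  rw [mem_iInter] at hP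
  rw [Metric.mem_closure_iff]
  intro ε hε
  -- rationals `q₁ ∈ (max 0 (l - ε), l)` and `q₂ ∈ (l, min (l + ε) (a P))`
  obtain ⟨q₁, hq₁l, hq₁u⟩ := exists_rat_btwn (max_lt hl0 (sub_lt_self l hε) : max 0 (l - ε) < l)
  obtain ⟨q₂, hq₂l, hq₂u⟩ := exists_rat_btwn (lt_min (lt_add_of_pos_right l hε) hla : l < min (l + ε) (a P))
  have hq0 : (0 : ℚ) ≤ q₁ := by exact_mod_cast (le_of_lt (lt_of_le_of_lt (le_max_left _ _) hq₁l))
  have hq12 : q₁ < q₂ := by exact_mod_cast (lt_trans hq₁u hq₂l)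
  have hPq : P ∈ sliceWitnessSet a W q₁ q₂ := hP ⟨(q₁, q₂), hq0, hq12⟩
  -- `P` is not in the interior term since `a P > l > q₁`
  rcases hPq with hproj | hint
  · obtain ⟨⟨l', P'⟩, ⟨hW', hI', -⟩, hPP'⟩ := hproj
    simp only at hPP'
    subst hPP'
    obtain ⟨h1', h2'⟩ := hI'
    refine ⟨l', ⟨hW', ?_, ?_⟩, ?_⟩
    · exact lt_of_le_of_lt (by exact_mod_cast hq0) h1'
    · exact lt_of_lt_of_le (lt_trans h2' hq₂u) (min_le_right _ _)
    · rw [Real.dist_eq, abs_sub_lt_iff]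
      constructor
      · have : l - ε < l' := lt_trans (lt_of_le_of_lt (le_max_right _ _) hq₁l) h1'
        linarith
      · have : l' < l + ε := lt_of_lt_of_le (lt_trans h2' hq₂u) (min_le_left _ _)
        linarith
  · exfalso
    have haP : P ∈ {P : X | a P ≤ (q₁ : ℝ)} := interior_subset hint
    simp only [mem_setOf_eq] at haP
    have : (q₁ : ℝ) < a P := lt_trans hq₁u hla
    linarith

/-- Relative version: `W = O ∩ cusp` RELATIVELY open in the cusp (`O` open in `ℝ × X`) and dense in it — the
literal reading of KZ20 Thm 1.2's "open and dense subset 𝒲 ⊊ 𝒱" when `𝒱` itself is not known to be open. Same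
conclusion, still with no hypothesis on `a`. [folklore] -/
theorem residual_setOf_slice_dense_of_relOpen {X : Type*} [TopologicalSpace X]
    (a : X → ℝ) {O W : Set (ℝ × X)} (hO : IsOpen O) (hW : W = O ∩ cuspSet a)
    (hWd : cuspSet a ⊆ closure W) :
    {P : X | Ioo 0 (a P) ⊆ closure (slice W P ∩ Ioo 0 (a P))} ∈ residual X := by
  have hOd : cuspSet a ⊆ closure O := hWd.trans (closure_mono (hW ▸ inter_subset_left))
  have heq : ∀ P : X, slice W P ∩ Ioo 0 (a P) = slice O P ∩ Ioo 0 (a P) := by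
    intro P
    ext l
    simp only [mem_inter_iff, mem_slice, hW, mem_Ioo]
    constructor
    · rintro ⟨⟨hO', -⟩, hI⟩
      exact ⟨hO', hI⟩
    · rintro ⟨hO', hI⟩
      exact ⟨⟨hO', hI⟩, hI⟩
  refine Filter.mem_of_superset (residual_setOf_slice_dense a O hO hOd) ?_
  intro P hP
  simp only [mem_setOf_eq] at hP ⊢
  rw [heq P]
  exact hP

/-- The same conclusion from the format in which KZ20 Thm 1.2 / L-gen-2 deliver it: a property `Good` that is
OPEN (hypothesis `(o)`, "open due to the smoothness of the flow") and dense in the cusp (any height `a`). For a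
residual set of directions the good amplitudes are (open and) dense in `(0, a P)`. [folklore] -/
theorem residual_setOf_fibre_dense_of_cusp_dense {X : Type*} [TopologicalSpace X]
    (a : X → ℝ) (Good : Set (ℝ × X)) (ho : IsOpen Good)
    (hd : cuspSet a ⊆ closure (Good ∩ cuspSet a)) :
    {P : X | IsOpen (slice Good P) ∧ Ioo 0 (a P) ⊆ closure (slice Good P ∩ Ioo 0 (a P))} ∈ residual X := by
  have hd' : cuspSet a ⊆ closure Good := hd.trans (closure_mono inter_subset_left)
  refine Filter.mem_of_superset (residual_setOf_slice_dense a Good ho hd') ?_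
  intro P hP
  exact ⟨isOpen_slice ho P, hP⟩

/-- Chaining L-gen-2 and L-gen-1: from FIBREWISE-dense good amplitudes over a set `ℜ` of directions satisfying
`(l)` (e.g. `ℜ` dense and `a` lower semicontinuous, `hl_of_dense_of_lsc`) and `Good` open, the good amplitudes are
dense in `(0, a P)` for a RESIDUAL set of directions `P` — residual-in, residual-out, through KZ's open-dense
class. [folklore] -/
theorem residual_setOf_fibre_dense_of_fibrewise_dense {X : Type*} [TopologicalSpace X]
    (a : X → ℝ) (Good : Set (ℝ × X)) (ℜ : Set X) (ho : IsOpen Good)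
    (hr : ∀ P ∈ ℜ, ∀ l₀, 0 < l₀ → l₀ < a P → ∀ η > 0,
      ∃ l, 0 < l ∧ l < a P ∧ |l - l₀| < η ∧ (l, P) ∈ Good)
    (hl : ∀ P₀ : X, ∀ l₀ : ℝ, l₀ < a P₀ → ∀ U ∈ 𝓝 P₀, ∃ P ∈ ℜ, P ∈ U ∧ l₀ < a P) :
    {P : X | IsOpen (slice Good P) ∧ Ioo 0 (a P) ⊆ closure (slice Good P ∩ Ioo 0 (a P))} ∈ residual X :=
  residual_setOf_fibre_dense_of_cusp_dense a Good ho (cusp_dense_of_fibrewise_dense a Good ℜ hr hl)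

end Literature.Dynamics.Hamiltonian.KaloshinZhang2020
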